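import Summits.ResolutionOfSingularities.ResolutionOfSingularities.Theorems.HomologicalConductorNoZenoSandwichClusterDefs
import Summits.ResolutionOfSingularities.ResolutionOfSingularities.Theorems.HomologicalConductorNoZenoCapture
import Summits.ResolutionOfSingularities.ResolutionOfSingularities.Theorems.HomologicalConductorNoZenoTowerNoetherian
import Literature.AlgebraicGeometry.Resolution.BaseTreeFiniteAnyResidueField
import Literature.AlgebraicGeometry.Resolution.QuadraticTransformsUFD
import Literature.RingTheory.KrullDimension.RegularLocalRingTrdeg
import Mathlib.RingTheory.DiscreteValuationRing.TFAE
import Mathlib.RingTheory.Valuation.ValuationRing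
import HarnessLib

/-!
# Crux `NoZenoR` (stmt-ResolutionOfSingularities-19943) = `NoZeno` (stmt-16483), line `birth`,
# skeleton v10 — stub **S1 `stub_basePtsFinite`** (Zariski finiteness of base points): PROVED

OURS (cell res-hironaka; chain W4.4, seat res-L0-w44-stub-1). Nothing here is a statement of the
manuscript under review; AI-written, weaker than expert review.

The stub (planner res-L0-w44-plan-1, CRUX-PLAN W4.4 v2 §2, line `sandwich-cluster`; vocabulary
`Theorems/HomologicalConductorNoZenoSandwichClusterDefs.lean`): for a datum in the sandwich context
(`SandwichCtx O A R m₀`: `A ⊆ O` finitely generated with `Frac A = K`, `tr.deg_k K = 2`, `R ⊆ O`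
regular with `Frac R = K`, `loc O R = R`, `R ≤ T_m` for `m ≥ m₀`) every stage `T_m = tower O A m`,
`m ≥ m₀ + 1`, has finitely many BASE POINTS over `R` — two-dimensional regular local `k`-subalgebras
`S ⊇ R` of `K` with `¬ T_m ≤ S` whose order pseudo-valuation ring `ordSet S` dominates `T_m`.

Proof (the dictionary, then Zariski):
* `subringDominates_of_mem_basePts` — a base point `S` DOMINATES `R`: an element of `R` invertible
  in `S ⊆ ordSet S` is invertible in `T_m` (domination of `T_m` by `ordSet S`), hence in `O`, hence
  in `loc O R = R`;
* `emb dim R ≤ tr.deg_k K = 2` (`Literature.RingTheory.KrullDimension`: a regular system of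
  parameters is algebraically independent over `k`); if `dim R ≤ 1` then `R` is a valuation ring of
  `K` and so is every `S ⊇ R`, whence `dim S ≤ 1`: no base points (`basePts_eq_empty_of_spanFinrank_le_one`);
* if `dim R = 2`: `T_m` is essentially of finite type over `k` (`tn_tower_invariant`), i.e. a
  localisation of `k[t₁, …, t_n]`, `tᵢ = aᵢ/c` with `aᵢ, c ∈ R`; for the ideal `J = (c, a₁, …, a_n)`
  of `R` and a base point `S`, `J S` is NOT principal (`not_isPrincipal_extIdeal_of_mem_basePts`):
  a principal `J S` is generated by `c` or by some `aⱼ` (local ring), and either way all `tᵢ ∈ S`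
  (using stub-2's `inv_mem_of_inv_mem_ordSet`: an element of `S` whose inverse lies in `ordSet S`
  is a unit of `S`), so `k[t] ⊆ S` and the units of `T_m` are units of `S`: `T_m ≤ S`, contradiction
  (`le_of_generators_mem`);
* so `basePts R T_m` embeds (`S ↦ S.toSubring`) into the set of two-dimensional regular local rings
  of `K` dominating `R` at which `J₀` (the `𝔪_R`-primary part of `J = (g)·J₀`) is not principal —
  FINITE by Zariski's finiteness of base points over an arbitrary residue field
  (`Literature.AlgebraicGeometry.Resolution.finite_setOf_subringDominates_not_isPrincipal`,
  Zariski–Samuel II App. 5 via Nagata's `R(X)` and Abhyankar's factorization theorem).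

References: O. Zariski, P. Samuel, *Commutative Algebra* II, App. 5 [`ZariskiSamuel1960`];
S. Abhyankar, Amer. J. Math. 78 (1956) Thm 3 [`Abhyankar1956Valuations`]; C. Huneke, I. Swanson
(2006) §8.4, §14.5 [`HunekeSwanson2006`]; M. Spivakovsky, Ann. of Math. 131 (1990) §II
[`Spivakovsky1990`].
-/

-- single-problem summit: the doubled namespace component `ResolutionOfSingularities` is forced
set_option linter.dupNamespace false

noncomputable section

open Summit.ResolutionOfSingularities.ResolutionOfSingularities.Theses.HomologicalConductor

namespace Summit.ResolutionOfSingularities.ResolutionOfSingularities.Theorems.NoZeno.SandwichCluster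

open Summit.ResolutionOfSingularities.ResolutionOfSingularities.Theorems.NoZeno.Birth
open Literature.AlgebraicGeometry.Resolution IsLocalRing

variable {k K : Type} [Field k] [Field K] [Algebra k K]

/-! ## The dictionary: base points dominate `R` -/

/-- A local subalgebra lies in its order pseudo-valuation ring (`s = s · 1⁻¹`, `1 ∉ 𝔪`). [folklore] -/
theorem self_subset_ordSet (S : Subalgebra k K) (hS : IsLocalRing ↥S) : (S : Set K) ⊆ ordSet S := by
  intro x hx
  refine ⟨0, ⟨x, hx⟩, 1, ?_, ?_, ?_, by simp⟩
  · rw [pow_zero, Ideal.one_eq_top]; exact Submodule.mem_top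
  · rw [pow_zero, Ideal.one_eq_top]; exact Submodule.mem_top
  · rw [zero_add, pow_one, IsLocalRing.jacobson_eq_maximalIdeal ⊥ bot_ne_top]
    exact fun h => (IsLocalRing.maximalIdeal.isMaximal ↥S).ne_top ((Ideal.eq_top_iff_one _).mpr h)

/-- **A base point of a late stage dominates `R`.** If `S ∈ basePts R T_m` (`m ≥ m₀`) then every
element of `R` invertible in `S` is invertible in `R`: its inverse lies in `S ⊆ ordSet S`, hence
(domination of `T_m` by `ordSet S`) in `T_m ⊆ O`, hence in `loc O R = R`.
[cite: Spivakovsky1990, §II; ZariskiSamuel1960, Appendix 5] -/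
theorem subringDominates_of_mem_basePts (O : ValuationSubring K) (A R : Subalgebra k K) (m₀ : ℕ)
    (ctx : SandwichCtx O A R m₀) {m : ℕ} (hm : m₀ ≤ m) {S : Subalgebra k K}
    (hS : S ∈ basePts R (tower O A m)) : SubringDominates R.toSubring S.toSubring := by
  obtain ⟨hk, hA, hfr, hAO, -, -, -, -, hloc, hRT⟩ := ctx
  obtain ⟨hRS, hreg, -, -, hdom⟩ := hS
  refine ⟨fun x hx => hRS hx, fun r hr hrinv => ?_⟩
  have hrT : r ∈ tower O A m := hRT m hm hr
  have hTO := (tn_tower_invariant O A hk hA hfr hAO m).2.1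
  have h1 : r⁻¹ ∈ tower O A m := (hdom r hrT).2 (self_subset_ordSet S hreg.toIsLocalRing hrinv)
  have h2 : r⁻¹ ∈ O := hTO h1
  have h3 : r⁻¹ ∈ loc O R := Algebra.subset_adjoin ⟨1, R.one_mem, r, hr, h2, by rw [one_mul]⟩
  rw [hloc] at h3
  exact h3

/-- `R ⊆ K` with `Frac R = K` is a local ring of `K` in the sense of `QuadraticTransforms.lean`.
[folklore] -/
theorem isLocalRingOf_toSubring (R : Subalgebra k K) (hR : IsLocalRing ↥R)
    (hfr : IsFractionRing ↥R K) : IsLocalRingOf R.toSubring := by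
  refine ⟨hR, fun z => ?_⟩
  obtain ⟨a, b, hb, rfl⟩ := IsFractionRing.div_surjective (A := ↥R) z
  exact ⟨a, a.2, b, b.2, fun h => nonZeroDivisors.ne_zero hb (Subtype.ext h), rfl⟩

/-! ## No base points over a regular `R` of dimension `≤ 1` -/

/-- If `emb dim R ≤ 1` then `R` is a valuation ring of `K`, so is every `S ⊇ R`, and a regular
`S ⊇ R` has dimension `≤ 1`: there are no (two-dimensional) base points. [folklore] -/
theorem basePts_eq_empty_of_spanFinrank_le_one (R T : Subalgebra k K) (hRreg : IsRegularLocalRing ↥R)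
    (hRfr : IsFractionRing ↥R K) (hd : (maximalIdeal ↥R).spanFinrank ≤ 1) : basePts R T = ∅ := by
  haveI := hRreg
  haveI := hRfr
  have hdim : ringKrullDim ↥R ≤ 1 := by
    rw [Literature.RingTheory.KrullDimension.ringKrullDim_eq_spanFinrank]
    exact_mod_cast hd
  haveI : IsPrincipalIdealRing ↥R := isPrincipalIdealRing_of_ringKrullDim_le_one hdim
  haveI : ValuationRing ↥R :=
    ((tfae_of_isNoetherianRing_of_isLocalRing_of_isDomain ↥R).out 0 1).mp ‹_›
  have hval : ∀ z : K, z ∈ R ∨ z⁻¹ ∈ R := by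
    intro z
    rcases (ValuationRing.iff_isInteger_or_isInteger ↥R K).mp ‹_› z with ⟨r, hr⟩ | ⟨r, hr⟩
    · left; rw [← hr]; exact r.2
    · right; rw [← hr]; exact r.2
  ext S
  simp only [Set.mem_empty_iff_false, iff_false]
  rintro ⟨hRS, hSreg, hSdim, -, -⟩
  haveI := hSreg
  have hvalS : ∀ z : K, z ∈ S.toSubring ∨ z⁻¹ ∈ S.toSubring := fun z =>
    (hval z).imp (fun h => hRS h) (fun h => hRS h)
  haveI : IsPrincipalIdealRing ↥S.toSubring := ⟨fun I => isPrincipal_of_forall_mem_or_inv_mem hvalS I⟩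
  have hle : ringKrullDim ↥S.toSubring ≤ 1 := Ring.krullDimLE_iff.mp inferInstance
  have h2 : ringKrullDim ↥S.toSubring = 2 := hSdim
  rw [h2] at hle
  exact absurd hle (by norm_num)

/-! ## The ideal `J` of `R` whose extension to a base point is not principal -/

/-- A common denominator in `R` (`Frac R = K`) for finitely many elements of `K`. [folklore] -/
theorem exists_mul_mem_of_finset (R : Subalgebra k K) (hfr : IsFractionRing ↥R K) (σ : Finset K) :
    ∃ c : K, c ∈ R ∧ c ≠ 0 ∧ ∀ t ∈ σ, c * t ∈ R := by
  classical
  haveI := hfr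
  induction σ using Finset.induction_on with
  | empty => exact ⟨1, R.one_mem, one_ne_zero, fun t ht => absurd ht (Finset.notMem_empty t)⟩
  | insert t σ hnot ih =>
    obtain ⟨c, hcR, hc0, hc⟩ := ih
    obtain ⟨a, b, hb, hab⟩ := IsFractionRing.div_surjective (A := ↥R) t
    have hb0 : ((b : ↥R) : K) ≠ 0 := fun h => nonZeroDivisors.ne_zero hb (Subtype.ext h)
    refine ⟨c * (b : K), R.mul_mem hcR b.2, mul_ne_zero hc0 hb0, fun t' ht' => ?_⟩
    rcases Finset.mem_insert.mp ht' with rfl | ht'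
    · rw [← hab]
      change c * (b : K) * ((a : K) / (b : K)) ∈ R
      rw [mul_assoc, mul_div_cancel₀ (a : K) hb0]
      exact R.mul_mem hcR a.2
    · rw [mul_right_comm]
      exact R.mul_mem (hc t' ht') b.2

/-- **Generators test for `T ≤ S`.** If `T` is the localisation of `k[σ]` at the elements invertible
in `T` (essential finite type), `ordSet S` dominates `T` for a local `S`, and `σ ⊆ S`, then `T ≤ S`:
`k[σ] ⊆ S`, and a unit `t` of `T` lying in `S` has `t⁻¹ ∈ T ⊆ ordSet S`, so `t⁻¹ ∈ S`
(`inv_mem_of_inv_mem_ordSet`). [folklore] -/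
theorem le_of_generators_mem {T S : Subalgebra k K} (hSloc : IsLocalRing ↥S)
    (hdom : Dominates (ordSet S) T) (σ : Finset ↥T)
    (hσ : IsLocalization ((IsUnit.submonoid ↥T).comap
      (algebraMap (Algebra.adjoin k (σ : Set ↥T)) ↥T)) ↥T)
    (hgen : ∀ t ∈ σ, ((t : ↥T) : K) ∈ S) : T ≤ S := by
  have hadj : ∀ x ∈ Algebra.adjoin k ((σ : Set ↥T)), ((x : ↥T) : K) ∈ S := by
    intro x hx
    induction hx using Algebra.adjoin_induction with
    | mem x hx => exact hgen x hx
    | algebraMap c => rw [Subalgebra.coe_algebraMap]; exact S.algebraMap_mem c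
    | add x y _ _ hx hy => rw [Subalgebra.coe_add]; exact S.add_mem hx hy
    | mul x y _ _ hx hy => rw [Subalgebra.coe_mul]; exact S.mul_mem hx hy
  intro s hs
  obtain ⟨t, ht, htu, hst⟩ := (Algebra.essFiniteType_cond_iff k ↥T σ).mp hσ ⟨s, hs⟩
  have htS : (t : K) ∈ S := hadj t ht
  have hstS : s * (t : K) ∈ S := by
    have := hadj _ hst
    rwa [Subalgebra.coe_mul] at this
  obtain ⟨t', ht'⟩ := htu.exists_right_inv
  have htt' : (t : K) * (t' : K) = 1 := by
    have := congrArg (fun z : ↥T => (z : K)) ht'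
    simpa using this
  have ht0 : (t : K) ≠ 0 := left_ne_zero_of_mul_eq_one htt'
  have htinvT : (t : K)⁻¹ ∈ T := by
    rw [inv_eq_of_mul_eq_one_right htt']
    exact t'.2
  have htinvS : (t : K)⁻¹ ∈ S :=
    inv_mem_of_inv_mem_ordSet S hSloc (t : K) htS ((hdom _ htinvT).1)
  have hs' : s = s * (t : K) * (t : K)⁻¹ := by rw [mul_assoc, mul_inv_cancel₀ ht0, mul_one]
  rw [hs']
  exact S.mul_mem hstS htinvS

/-- **The ideal `J`.** For every stage `T_m` there is a non-zero ideal `J = (c, c t₁, …, c t_n)` of `R`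
(`T_m` a localisation of `k[t₁, …, t_n]`, `c` a common denominator of the `tᵢ` in `R`) whose
extension `J S` to any base point `S` of `T_m` is NOT principal: a principal `J S` is generated by
`c` or by some `c tⱼ` (local ring), and either way all `tᵢ ∈ S`, forcing `T_m ≤ S`.
[cite: Spivakovsky1990, §II; ZariskiSamuel1960, Appendix 5] -/
theorem exists_ideal_forall_not_isPrincipal (O : ValuationSubring K) (A R : Subalgebra k K)
    (m₀ : ℕ) (ctx : SandwichCtx O A R m₀) (m : ℕ) :
    ∃ J : Ideal ↥R.toSubring, J ≠ ⊥ ∧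
      ∀ S ∈ basePts R (tower O A m), ¬ (extIdeal J S.toSubring).IsPrincipal := by
  classical
  obtain ⟨hk, hA, hfr, hAO, -, -, hRfr, -, -, -⟩ := ctx
  haveI hET : Algebra.EssFiniteType k ↥(tower O A m) := (tn_tower_invariant O A hk hA hfr hAO m).2.2
  obtain ⟨σ, hσ⟩ := hET.cond
  obtain ⟨c, hcR, hc0, hc⟩ :=
    exists_mul_mem_of_finset R hRfr (σ.image fun t : ↥(tower O A m) => (t : K))
  have hct : ∀ t ∈ σ, c * ((t : ↥(tower O A m)) : K) ∈ R := fun t ht =>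
    hc _ (Finset.mem_image_of_mem _ ht)
  -- the generating set of `J`
  set G : Set ↥R.toSubring :=
    {x | (x : K) = c ∨ ∃ t ∈ σ, (x : K) = c * ((t : ↥(tower O A m)) : K)} with hG
  have hcG : (⟨c, hcR⟩ : ↥R.toSubring) ∈ G := Or.inl rfl
  refine ⟨Ideal.span G, ?_, ?_⟩
  · intro h0
    have hmem : (⟨c, hcR⟩ : ↥R.toSubring) ∈ Ideal.span G := Ideal.subset_span hcG
    rw [h0, Ideal.mem_bot] at hmem
    exact hc0 (congrArg Subtype.val hmem)
  · intro S hS hprinc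
    obtain ⟨hRS, hSreg, -, hnot, hdom⟩ := hS
    haveI := hSreg
    have h : R.toSubring ≤ S.toSubring := fun x hx => hRS hx
    rw [extIdeal_eq_map _ h, Ideal.map_span] at hprinc
    -- the spanning set is finite and non-empty
    have hGfin : (Subring.inclusion h '' G).Finite := by
      refine Set.Finite.image _ (Set.Finite.of_finite_image (f := fun x : ↥R.toSubring => (x : K))
        ?_ Subtype.val_injective.injOn)
      refine (Finset.finite_toSet (insert c (σ.image fun t : ↥(tower O A m) =>
        c * (t : K)))).subset ?_
      rintro _ ⟨x, hx, rfl⟩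
      change (x : K) ∈ ((insert c (σ.image fun t : ↥(tower O A m) => c * (t : K)) :
        Finset K) : Set K)
      rcases hx with hx | ⟨t, ht, hx⟩
      · rw [hx]; exact Finset.mem_coe.mpr (Finset.mem_insert_self _ _)
      · rw [hx]
        exact Finset.mem_coe.mpr (Finset.mem_insert_of_mem (Finset.mem_image_of_mem _ ht))
    have hspanG : Ideal.span ((hGfin.toFinset : Finset ↥S.toSubring) : Set ↥S.toSubring) =
        Ideal.span (Subring.inclusion h '' G) := by rw [Set.Finite.coe_toFinset]
    obtain ⟨y, hy, hspan⟩ := exists_span_eq_span_singleton_of_isPrincipal hGfin.toFinset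
      ⟨Subring.inclusion h ⟨c, hcR⟩, by
        rw [Set.Finite.mem_toFinset]; exact Set.mem_image_of_mem _ hcG⟩
      (by rw [hspanG]; exact hprinc)
    rw [hspanG] at hspan
    rw [Set.Finite.mem_toFinset] at hy
    obtain ⟨g, hgG, rfl⟩ := hy
    -- every generator is a multiple of `g` in `S`
    have hmul : ∀ x ∈ G, ∃ u : K, u ∈ S ∧ (x : K) = u * (g : K) := by
      intro x hx
      have hmem : Subring.inclusion h x ∈ Ideal.span {Subring.inclusion h g} :=
        hspan ▸ Ideal.subset_span (Set.mem_image_of_mem _ hx)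
      obtain ⟨u, hu⟩ := Ideal.mem_span_singleton'.mp hmem
      exact ⟨u, u.2, by simpa using (congrArg Subtype.val hu).symm⟩
    -- in both cases all `tᵢ ∈ S`
    have hgen : ∀ t ∈ σ, ((t : ↥(tower O A m)) : K) ∈ S := by
      rcases hgG with hgc | ⟨t₀, ht₀, hgt₀⟩
      · intro t ht
        obtain ⟨u, huS, hu⟩ := hmul ⟨c * (t : K), hct t ht⟩ (Or.inr ⟨t, ht, rfl⟩)
        rw [hgc] at hu
        -- `c t = u c`, so `t = u`
        have : ((t : ↥(tower O A m)) : K) = u := by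
          have := hu; rw [mul_comm u c] at this
          exact mul_left_cancel₀ hc0 this
        rw [this]; exact huS
      · obtain ⟨u, huS, hu⟩ := hmul ⟨c, hcR⟩ hcG
        rw [hgt₀] at hu
        -- `c = u c t₀`, so `u t₀ = 1`: `t₀⁻¹ = u ∈ S`, and `t₀ ∈ ordSet S`, so `t₀ ∈ S`
        have hu1 : c = u * (c * ((t₀ : ↥(tower O A m)) : K)) := hu
        have hut : u * ((t₀ : ↥(tower O A m)) : K) = 1 := by
          have h1 : c * 1 = c * (u * ((t₀ : ↥(tower O A m)) : K)) :=
            calc c * 1 = c := mul_one c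
              _ = u * (c * ((t₀ : ↥(tower O A m)) : K)) := hu1
              _ = c * (u * ((t₀ : ↥(tower O A m)) : K)) := by ring
          exact (mul_left_cancel₀ hc0 h1).symm
        have hu0 : u ≠ 0 := left_ne_zero_of_mul_eq_one hut
        have huinv : u⁻¹ = ((t₀ : ↥(tower O A m)) : K) := inv_eq_of_mul_eq_one_right hut
        have ht₀S : ((t₀ : ↥(tower O A m)) : K) ∈ S := by
          rw [← huinv]
          refine inv_mem_of_inv_mem_ordSet S hSreg.toIsLocalRing u huS ?_
          rw [huinv]; exact (hdom _ t₀.2).1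
        intro t ht
        obtain ⟨u', hu'S, hu'⟩ := hmul ⟨c * (t : K), hct t ht⟩ (Or.inr ⟨t, ht, rfl⟩)
        rw [hgt₀] at hu'
        have hu2 : c * ((t : ↥(tower O A m)) : K) = u' * (c * ((t₀ : ↥(tower O A m)) : K)) := hu'
        have : ((t : ↥(tower O A m)) : K) = u' * ((t₀ : ↥(tower O A m)) : K) := by
          have h1 : c * ((t : ↥(tower O A m)) : K) = c * (u' * ((t₀ : ↥(tower O A m)) : K)) :=
            hu2.trans (by ring)
          exact mul_left_cancel₀ hc0 h1
        rw [this]; exact S.mul_mem hu'S ht₀S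
    exact hnot (le_of_generators_mem hSreg.toIsLocalRing hdom σ hσ hgen)

/-- **STUB S1 `stub_basePtsFinite` of crux `NoZenoR`/`NoZeno`, line `birth` v10 (lead
res-L0-w44-lead-1) = line `sandwich-cluster` S1 (planner res-L0-w44-plan-1): PROVED.**  Every late
stage `T_m` (`m ≥ m₀ + 1`) of the canonical normalised `ca`-tower of a datum in the sandwich context
has finitely many base points over `R`.  Proof: `emb dim R ≤ tr.deg_k K = 2`; if `≤ 1`, `R` is a
valuation ring and there are no base points; if `= 2`, base points dominate `R` and fail to
principalize the ideal `J` of `exists_ideal_forall_not_isPrincipal`, hence its `𝔪_R`-primary part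
`J₀`, and Zariski's finiteness of base points (any residue field:
`finite_setOf_subringDominates_not_isPrincipal`) bounds them. The registered signature, verbatim.
[cite: ZariskiSamuel1960, Appendix 5; Abhyankar1956Valuations, Thm 3; Spivakovsky1990, §II] -/
theorem stub_basePtsFinite (p : ℕ) (hp : p.Prime) (k K : Type) [Field k] [CharP k p] [Field K]
    [Algebra k K] (O : ValuationSubring K) (A R : Subalgebra k K) (m₀ : ℕ)
    (ctx : SandwichCtx O A R m₀) (m : ℕ) (hm : m₀ + 1 ≤ m) :
    (basePts R (tower O A m)).Finite := by
  classical
  have _hchar : p.Prime := hp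
  have hRreg : IsRegularLocalRing ↥R := ctx.2.2.2.2.2.1
  have hRfr : IsFractionRing ↥R K := ctx.2.2.2.2.2.2.1
  have htr : Algebra.trdeg k K = 2 := ctx.2.2.2.2.1
  haveI := hRreg
  haveI := hRfr
  -- `emb dim R ≤ tr.deg_k K = 2`
  have hd2 : (maximalIdeal ↥R).spanFinrank ≤ 2 := by
    have h := Literature.RingTheory.KrullDimension.spanFinrank_maximalIdeal_le_trdeg_of_injective
      (k := k) (R := ↥R) (L := K) R.val Subtype.val_injective
    rw [htr] at h
    exact_mod_cast h
  rcases Nat.lt_or_ge (maximalIdeal ↥R).spanFinrank 2 with hlt | hge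
  · rw [basePts_eq_empty_of_spanFinrank_le_one R _ hRreg hRfr (by omega)]
    exact Set.finite_empty
  have hd : (maximalIdeal ↥R).spanFinrank = 2 := le_antisymm hd2 hge
  -- the two-dimensional case: Zariski
  haveI hRreg' : IsRegularLocalRing ↥R.toSubring := hRreg
  have hdim : ringKrullDim ↥R.toSubring = 2 := by
    rw [Literature.RingTheory.KrullDimension.ringKrullDim_eq_spanFinrank]
    change (((maximalIdeal ↥R).spanFinrank : ℕ) : WithBot ℕ∞) = 2
    rw [hd]; rfl
  have hRK : IsLocalRingOf R.toSubring := isLocalRingOf_toSubring R inferInstance hRfr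
  obtain ⟨J, hJ0, hJ⟩ := exists_ideal_forall_not_isPrincipal O A R m₀ ctx m
  obtain ⟨g, J₀, hg0, hJg, hJ₀⟩ := exists_eq_span_singleton_mul_forall_not_le J hJ0
  have hJ₀0 : J₀ ≠ ⊥ := by
    rintro rfl; apply hJ0; rw [hJg, Ideal.mul_bot]
  have hfin : IsFiniteLength ↥R.toSubring (↥R.toSubring ⧸ J₀) :=
    isFiniteLength_quotient_of_forall_not_le hdim hJ₀
  have hF := finite_setOf_subringDominates_not_isPrincipal hdim hRK hJ₀0 hfin
  refine Set.Finite.of_finite_image (f := fun S : Subalgebra k K => S.toSubring) (hF.subset ?_)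
    Subalgebra.toSubring_injective.injOn
  rintro _ ⟨S, hS, rfl⟩
  have hdom := subringDominates_of_mem_basePts O A R m₀ ctx (by omega : m₀ ≤ m) hS
  have hbad := hJ S hS
  obtain ⟨hRS, hSreg, hSdim, -, -⟩ := hS
  haveI : IsRegularLocalRing ↥S.toSubring := hSreg
  refine ⟨hSreg, hSdim, hdom, fun hp0 => hbad ?_⟩
  -- `J S = (g) · J₀ S` is principal iff `J₀ S` is
  have h : R.toSubring ≤ S.toSubring := hdom.1
  have e : extIdeal J S.toSubring =
      Ideal.span {Subring.inclusion h g} * extIdeal J₀ S.toSubring := by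
    rw [extIdeal_eq_map _ h, extIdeal_eq_map _ h, hJg, Ideal.map_mul, Ideal.map_span,
      Set.image_singleton]
  rw [e]
  refine (isPrincipal_span_singleton_mul_iff ?_ _).mpr hp0
  intro h0
  exact hg0 (Subtype.ext (congrArg (fun z : ↥S.toSubring => (z : K)) h0))

/-! ## Packaging for the other stubs of the line: base points are infinitely near points of `R` -/

/-- **If a stage has a base point then `dim R = 2`** (`emb dim R ≤ 2` by the transcendence degree,
`≥ 2` because a regular `R` of dimension `≤ 1` has no base points). [folklore] -/
theorem ringKrullDim_eq_two_of_mem_basePts (O : ValuationSubring K) (A R : Subalgebra k K) (m₀ : ℕ)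
    (ctx : SandwichCtx O A R m₀) {m : ℕ} {S : Subalgebra k K} (hS : S ∈ basePts R (tower O A m)) :
    ringKrullDim ↥R = 2 := by
  have hRreg : IsRegularLocalRing ↥R := ctx.2.2.2.2.2.1
  have hRfr : IsFractionRing ↥R K := ctx.2.2.2.2.2.2.1
  have htr : Algebra.trdeg k K = 2 := ctx.2.2.2.2.1
  haveI := hRreg
  have hd2 : (maximalIdeal ↥R).spanFinrank ≤ 2 := by
    have h := Literature.RingTheory.KrullDimension.spanFinrank_maximalIdeal_le_trdeg_of_injective
      (k := k) (R := ↥R) (L := K) R.val Subtype.val_injective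
    rw [htr] at h
    exact_mod_cast h
  rcases Nat.lt_or_ge (maximalIdeal ↥R).spanFinrank 2 with hlt | hge
  · exfalso
    have he := basePts_eq_empty_of_spanFinrank_le_one R (tower O A m) hRreg hRfr (by omega)
    rw [he] at hS
    exact hS
  have hd : (maximalIdeal ↥R).spanFinrank = 2 := le_antisymm hd2 hge
  rw [Literature.RingTheory.KrullDimension.ringKrullDim_eq_spanFinrank, hd]
  rfl

/-- **A base point is a point infinitely near to `R`** (Huneke–Swanson Def. 14.5.1 / Abhyankar's
factorization theorem, Thm. 14.5.2): for `S ∈ basePts R T_m` (`m ≥ m₀`) a finite chain of quadratic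
transforms leads from `R` to `S` inside `K` — `S` is a two-dimensional regular local ring of `K`
dominating the two-dimensional regular `R` (`subringDominates_of_mem_basePts`), so the tree's
`AbhyankarQuadraticFactorization_holds` applies. [cite: Abhyankar1956Valuations, Thm 3;
HunekeSwanson2006, Thm. 14.5.2] -/
theorem reflTransGen_isQuadraticTransform_of_mem_basePts (O : ValuationSubring K)
    (A R : Subalgebra k K) (m₀ : ℕ) (ctx : SandwichCtx O A R m₀) {m : ℕ} (hm : m₀ ≤ m)
    {S : Subalgebra k K} (hS : S ∈ basePts R (tower O A m)) :
    Relation.ReflTransGen IsQuadraticTransform R.toSubring S.toSubring := by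
  have hRreg : IsRegularLocalRing ↥R := ctx.2.2.2.2.2.1
  have hRfr : IsFractionRing ↥R K := ctx.2.2.2.2.2.2.1
  have hdim := ringKrullDim_eq_two_of_mem_basePts O A R m₀ ctx hS
  have hdom := subringDominates_of_mem_basePts O A R m₀ ctx hm hS
  obtain ⟨-, hSreg, hSdim, -, -⟩ := hS
  haveI : IsRegularLocalRing ↥R.toSubring := hRreg
  haveI : IsRegularLocalRing ↥S.toSubring := hSreg
  exact AbhyankarQuadraticFactorization_holds K R.toSubring S.toSubring hRreg hdim
    (isLocalRingOf_toSubring R inferInstance hRfr) hSreg hSdim hdom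

end Summit.ResolutionOfSingularities.ResolutionOfSingularities.Theorems.NoZeno.SandwichCluster

end
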